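import Summits.QuantumFields.YangMills.Theorems.PencilRigidityDiagonalMirrorRPRStubRpClosureDefs

/-!
# Crux `DiagonalMirrorRPR` (stmt-QuantumFields-10604), line `sign-twisted-diagonal-trace`: the INTERFACE of the
# W₁-free core, re-homed under `Theorems/` (importable vocabulary root)

Helper for the crux `DiagonalMirrorRPR` of `YangMills` (routes `IsotropyFromPowerCounting`, `MirrorModularBoosts`,
`PencilRigidity`; item stmt-QuantumFields-10604), attached `--supports … --as helper`; it closes nothing by itself.

Docket: director-ym g22, O4 WORD 3 ruling (A) on idea-crit-9 g12's REV-PRICE π1 of line #108 (core workfile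
`Cruxes/DiagonalMirrorRPR/Lines/sign_twisted_diagonal_trace_core.lean`, sha16 `8055703b7f1e70ed`): the construction
`wilsonDiagonalModel r sch hβ : DiagonalSliceModel r sch` must be landed under `Theorems/`, which cannot import a
`Cruxes/` workfile.  This module therefore RE-HOMES the interface from §1–§2 of the core — the four declarations
`ReflectedFamily`, `famObs`, `gramPairing`, `DiagonalSliceModel` — with their docstrings and bodies
BYTE-FOR-BYTE and in the SAME namespace `…Cruxes.DiagonalMirrorRPR.SignTwistedDiagonalTrace` (the pattern of the
crux's other vocabulary roots `…StubRpClosureDefs`, `…KmsVarianceDefs`, `…CentreTwistDefs`, `…SliceDefs`: the line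
writer re-points the core by replacing its §1–§2 with `import` of this file; nothing else in the core changes and every
later signature — `OddTwistGap 𝔪`, `DiagLukewarm 𝔪`, `core_of`, `stub_closure` — elaborates unchanged against it).
No new mathematics, no instance, no notation; docstrings are the core's.

HONEST FRAMING: vocabulary only.  The interface `DiagonalSliceModel` is junk-inhabitable as a bare `Nonempty`
(idea-crit-9 g12, certificate `nonempty_model_of_cauchySchwarz`); its content is carried by WHICH model the letters are
typed on — the Wilson diagonal two-step transfer construction (`…WilsonDiagonalModelDefs` / `…WilsonDiagonalModel`,
this hand).  ⟨10604⟩ (aside-to-be) and ⟨17721⟩ are OPEN; the crux as typed is misstated (FOLD restate pending);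
nothing here bears on the summit; the Yang–Mills mass gap is NOT proved here or anywhere in the tree.

References: Osterwalder–Seiler, Ann. Phys. 110 (1978) §2–3; Seiler, LNP 159 (1982) Ch. 2.
-/

set_option autoImplicit false

noncomputable section

open scoped SchwartzMap
open MeasureTheory Filter Topology
open Literature.MathematicalPhysics.QuantumLattice Literature.MathematicalPhysics.AQFT
  Literature.MathematicalPhysics.QuantumFieldTheory Literature.Probability.LatticeModels
open Summit.QuantumFields.YangMills.Cruxes.DiagonalMirrorRPR.ParityBridgeColdTraces (E4)
open Summit.QuantumFields.YangMills.Cruxes.DiagonalMirrorRPR.ParityBridgeColdTraces.RpClosure (swap01)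

namespace Summit.QuantumFields.YangMills.Cruxes.DiagonalMirrorRPR.SignTwistedDiagonalTrace

/-! ## §1 Reflected families and their Gram pairing — core §1 verbatim (the line's conclusion
`OddTorusSwapPairingLiminf` stays in the core: it is the line writer's, not part of the interface the model inhabits) -/

section Statement

variable {G : Type} [Group G] [TopologicalSpace G] [IsTopologicalGroup G] [CompactSpace G]
  [MeasurableSpace G] [BorelSpace G]

/-- A reflected family: `m` products of `n` smeared curvature fields, coefficients `c`, test functions with compact
support in `{x₁ < x₀}`, and the swap-mirrored test functions `σf`. -/
structure ReflectedFamily where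
  /-- number of products -/
  m : ℕ
  /-- number of factors of each product (its degree) -/
  n : Fin m → ℕ
  /-- real coefficients -/
  c : Fin m → ℝ
  /-- test functions -/
  f : (i : Fin m) → Fin (n i) → 𝓢(E4, ℝ)
  /-- mirrored test functions -/
  σf : (i : Fin m) → Fin (n i) → 𝓢(E4, ℝ)
  compact : ∀ i j, HasCompactSupport (f i j : E4 → ℝ)
  half : ∀ i j, tsupport (f i j : E4 → ℝ) ⊆ {x : E4 | x 1 < x 0}
  mirror : ∀ i j (x : E4), σf i j x = f i (Fin.rev j) (swap01 x)

/-- The lattice observable `Y_k(F) = Σ_i c_i ∏_j Φ_k(f i j)` of a reflected family at step `k`, as a function of an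
(infinite-lattice) gauge configuration. -/
def famObs (r : LatticeRep G) (sch : SpeciesScheme (YMSpecies G)) (F : ReflectedFamily) (k : ℕ)
    (V : LGConfig 4 G) : ℝ :=
  ∑ i, F.c i * ∏ j, smearedLatticeField r.curvature.F (box 4 (sch.L k)) (sch.a k) (sch.c r.curvature k)
    (sch.m r.curvature k) (F.f i j) V

/-- The Gram pairing `⟨ΘY_k(F) · Y_k(F)⟩_k = Σ_{i,i'} c_i c_{i'} ⟨∏ Φ_k(σf i ·) ∏ Φ_k(f i' ·)⟩_k` at step `k`. -/
def gramPairing (r : LatticeRep G) (sch : SpeciesScheme (YMSpecies G)) (F : ReflectedFamily) (k : ℕ) : ℝ :=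
  ∑ i, ∑ i', F.c i * F.c i' *
    latticeSchwinger r.ρ sch (fun s => s.F) k (F.n i + F.n i') (fun _ => r.curvature) (Fin.append (F.σf i) (F.f i'))

end Statement

/-! ## §2 The interface: the two-sector spectral model of the odd root of the diagonal transfer operator — core §2
verbatim -/

section Model

variable {G : Type} [Group G] [TopologicalSpace G] [IsTopologicalGroup G] [CompactSpace G]
  [MeasurableSpace G] [BorelSpace G]

/-- **Interface (posited object; its construction is `stub_wilsonDiagonalModel`).**  At each step `k`, the
self-adjoint odd root `A_k = K_k W_k^{-(S_k+1)/2}` (`S_k = 2L_k+1`, `K_k` the one-step diagonal transfer operator of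
Wilson's measure on the slices `x₀ − x₁ = const` of the odd torus, `W_k` the unit translation along the slice,
`W_k^{S_k} = 1`, `K_k K_k^* = A_k²`) is Hilbert–Schmidt; `sp k j` (resp. `sm k j`) are the moduli of its eigenvalues on
the `U`-even (resp. `U`-odd) sector, `U = sgn A_k`, padded by zeros; `top k` is the top modulus.  For a reflected family
`F`, `wp F k j, wm F k j` are the diagonal Gram weights `⟨ψ_j, X_k(F) ψ_j⟩ ≥ 0` of its half-observable transported to
depth `depth F k`, so that (eventually in `k`, once the supports fit in the positive half of the torus)
`⟨ΘY·Y⟩_k · Tr A_k^{S_k} = Tr (X_k A_k^{S_k − 2d})` and `Tr (X_k |A_k|^{2t}) ≤ ‖Y_k‖_∞² · Tr |A_k|^{2t+2d}`. -/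
structure DiagonalSliceModel (r : LatticeRep G) (sch : SpeciesScheme (YMSpecies G)) where
  /-- moduli on the `U`-even sector -/
  sp : ℕ → ℕ → ℝ
  /-- moduli on the `U`-odd (wrong-sign) sector -/
  sm : ℕ → ℕ → ℝ
  /-- top modulus `λ₀(k) = ‖A_k‖` -/
  top : ℕ → ℝ
  top_pos : ∀ k, 0 < top k
  sp_nonneg : ∀ k j, 0 ≤ sp k j
  sm_nonneg : ∀ k j, 0 ≤ sm k j
  sp_le : ∀ k j, sp k j ≤ top k
  sm_le : ∀ k j, sm k j ≤ top k
  top_attained : ∀ k, ∃ j, sp k j = top k ∨ sm k j = top k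
  summable_sp : ∀ k, Summable fun j => sp k j ^ 2
  summable_sm : ∀ k, Summable fun j => sm k j ^ 2
  /-- kernel positivity: `Tr A_k^m ≥ 0` for odd `m ≥ 3` (a twisted-torus partition function) -/
  trace_nonneg : ∀ k m, 3 ≤ m → Odd m → ∑' j, sm k j ^ m ≤ ∑' j, sp k j ^ m
  /-- `Z_k = Tr A_k^{S_k} > 0` -/
  trace_side_pos : ∀ k, ∑' j, sm k j ^ sch.side k < ∑' j, sp k j ^ sch.side k
  /-- Gram weights of a reflected family on the two sectors -/
  wp : ReflectedFamily → ℕ → ℕ → ℝ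
  wm : ReflectedFamily → ℕ → ℕ → ℝ
  wp_nonneg : ∀ F k j, 0 ≤ wp F k j
  wm_nonneg : ∀ F k j, 0 ≤ wm F k j
  w_bdd : ∀ F k, ∃ W : ℝ, ∀ j, wp F k j ≤ W ∧ wm F k j ≤ W
  /-- diagonal depth (in lattice steps) of the family's support at step `k` -/
  depth : ReflectedFamily → ℕ → ℕ
  depth_le : ∀ F, ∃ R : ℝ, ∀ᶠ k in atTop, sch.a k * depth F k ≤ R
  /-- the pairing identity `⟨ΘY·Y⟩_k · Tr A^S = Tr (X A^{S−2d})` (eventually: once the supports fit) -/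
  pairing_eq : ∀ F, ∀ᶠ k in atTop, 2 * depth F k < sch.side k ∧
    gramPairing r sch F k * (∑' j, sp k j ^ sch.side k - ∑' j, sm k j ^ sch.side k) =
      ∑' j, sp k j ^ (sch.side k - 2 * depth F k) * wp F k j -
        ∑' j, sm k j ^ (sch.side k - 2 * depth F k) * wm F k j
  /-- weight domination by positive kernels: `Tr (X |A|^{2t}) ≤ ‖Y‖_∞² Tr |A|^{2t+2d}` -/
  weight_dom : ∀ F, ∀ᶠ k in atTop, ∀ (t : ℕ) (B : ℝ), (∀ V, |famObs r sch F k V| ≤ B) →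
    ∑' j, sp k j ^ (2 * t) * wp F k j + ∑' j, sm k j ^ (2 * t) * wm F k j ≤
      B ^ 2 * (∑' j, sp k j ^ (2 * t + 2 * depth F k) + ∑' j, sm k j ^ (2 * t + 2 * depth F k))

end Model

end Summit.QuantumFields.YangMills.Cruxes.DiagonalMirrorRPR.SignTwistedDiagonalTrace

end
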